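import Mathlib
import Summits.NavierStokesRegularity.NavierStokesRegularity.Theorems.StretchingWellBindingEnstrophyQuarterLawWindowToSliceTools
import Literature.Analysis.FluidPDE.TaoLocalisationProofs
import Summits.NavierStokesRegularity.NavierStokesRegularity.Theorems.StrongHypothesesBKMBoundBridge
import Summits.NavierStokesRegularity.NavierStokesRegularity.Theses.StretchingWellBinding
import Summits.NavierStokesRegularity.NavierStokesRegularity.Theses.TypeILiouville
import Summits.NavierStokesRegularity.NavierStokesRegularity.Theses.HalfHolderEnergy
import HarnessLib

/-!
# Converter `WindowToSlice`: sup-norm Type I + the window quarter law ⇒ the slice quarter law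
  (stub `stub_windowToSlice` of the shelf crux stmt-NavierStokesRegularity-1574 `EnstrophyQuarterLaw`,
  lines `Cruxes/EnstrophyQuarterLaw/Lines/window_average.lean` and `Lines/sparse_sieve.lean`, VERBATIM;
  part 2 of 2 — the analytic input `WindowToSlice.exists_enstrophy_rate` is in
  `StretchingWellBindingEnstrophyQuarterLawWindowToSliceTools.lean`)

**Statement** (`EnstrophyQuarterLaw.stub_windowToSlice`, literally the body of `WindowToSlice` in those
line files). Let `ν > 0`,
`T > 0`, `(u, p)` a maximal classical solution on `ℝ³ × [0, T)`, Leray–Hopf on `[0, T]` from a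
rapidly decaying datum, with Type-I velocity blow-up `‖u(t, x)‖ ≤ C/√(T − t)` for `t < T` near `T`
(`IsTypeIBlowup u T`) and the WINDOW law `∫_a^b ∫|curl u|² ≤ K √(b − a)` (`0 ≤ a ≤ b ≤ T`). Then the
SLICE law holds: `∫ |curl u(t)|² ≤ K'/√(T − t)` for every `t ∈ [0, T)`.

PROOF (the line card's «enstrophy balance + Grönwall over one window + average»; every PDE input is
a theorem of the tree).
1. *Serrin's enstrophy inequality at the endpoint `(2, ∞)`, pressure-free, quantitative*
   (`WindowToSlice.exists_enstrophy_rate`): for a classical solution on a closed slab `[0, S]` in Tao's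
   class (`HasBoundedSobolevNormsOn`) with `|u| ≤ M` there, `∫|∇u(s)|² ≤ e^{κ M² s} ∫|∇u(0)|²`
   (`κ = κ(ν)`). This is the chained piece bound `ForcedEnstrophyOfSupNorm.exists_piece_rate` of the
   tree (Lemarié-Rieusset 2016 Thm. 11.2 (11.11) at `r = ∞` applied to Tao's re-gauged local solution
   — `tao2011_smooth_local_existence_forced_holds` — so that NO hypothesis on the pressure `p` is
   needed) with force `0`, along a uniform partition, exactly as in the tree's
   `exists_enstrophy_le_of_norm_le_forced` but keeping the explicit rate.
2. *Tao's class on closed sub-slabs*: `hasBoundedSobolevNormsOn_of_classical_lerayHopf`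
   (Tao 2013 Cor. 11.1); hence also `|u| ≤ B` on `[0, t₂]` for any `t₂ < T`
   (`linfty_bound_of_hasBoundedSobolevNormsOn_holds`).
3. *Grönwall over one window.* For `t` close to `T` and `s ∈ (2t − T, t)`: on `[0, t]`,
   `|u| ≤ M_t := max(B, C⁺/√(T − t))` and `M_t² (t − s) ≤ M_t² (T − t) ≤ L := max(B² T, C⁺²)`, so
   step 1 for the shifted flow `u(· + s)` on `[0, t − s]` gives `∫|∇u(t)|² ≤ e^{κL} ∫|∇u(s)|²`.
4. *Average*: integrate over `s ∈ (2t − T, t)` (length `T − t`), bound `∫|∇u(s)|² ≤ ∫|curl u(s)|²`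
   (whole-space `div`–`curl` estimate `lintegral_frobeniusNormSq_fderiv_le_lintegral_sq_norm_curl`, the
   slices being `L²` by the Leray–Hopf energy inequality) and use the window law on `[2t − T, t]`:
   `(T − t) ∫|∇u(t)|² ≤ e^{κL} K⁺ √(T − t)`, i.e. `∫|∇u(t)|² ≤ e^{κL} K⁺/√(T − t)`; finally
   `|curl u|² ≤ ‖curlCLM‖² |∇u|²_F` pointwise. Early times `t < t₂` are covered by step 1 from time `0`
   (`∫|∇u(0)|² < ∞` for a rapidly decaying datum) and `1 ≤ √T/√(T − t)`.

Also recorded: the composition of line `window_average` BY NAME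
(`enstrophyQuarterLaw_of_noTypeII_of_energyHalfHolder`:
`TypeIliouvilleNoTypeII → EnergyHalfHolder → EnstrophyQuarterLaw`).

HONEST FRAMING: an a-priori converter between formulations of a HYPOTHETICAL blow-up (window law and
sup-rate Type I ⇒ slice law); `EnergyHalfHolder` (stmt-25161), `TypeIliouvilleNoTypeII` (stmt-0056) and
`EnstrophyQuarterLaw` (stmt-1574) are all OPEN and nothing here asserts any of them. No summit
statement is proved; nothing here bears on the regularity problem itself.
-/

noncomputable section

set_option linter.dupNamespace false

namespace Summit.NavierStokesRegularity.NavierStokesRegularity.Theorems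

open MeasureTheory Set Filter Topology Function Literature.Analysis.FluidPDE
open scoped NNReal ENNReal ContDiff

namespace EnstrophyQuarterLaw

open WindowToSlice in
/-- **`WindowToSlice` — sup-norm Type I + the window quarter law ⇒ the slice quarter law**
(stub `stub_windowToSlice` of `Cruxes/EnstrophyQuarterLaw/Lines/window_average.lean` /
`Lines/sparse_sieve.lean`, stated VERBATIM as the body of `WindowToSlice` there). For a maximal
classical Leray–Hopf solution from a rapidly decaying datum with `‖u(t)‖_∞ ≤ C/√(T − t)` near `T` and
`∫_a^b∫|curl u|² ≤ K√(b − a)` on all windows, `∫|curl u(t)|² ≤ K'/√(T − t)` on `[0, T)`: Serrin's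
enstrophy inequality at `(2, ∞)` over the window `[2t − T, t]` (exponent `κ M_t² (T − t) ≤ κ L`
uniformly), averaged in the starting time, plus the window law.
[cite: LemarieRieusset2016, Thm. 11.2 (11.11)] -/
theorem stub_windowToSlice :
    ∀ (ν T : ℝ), 0 < ν → 0 < T → ∀ (u : ℝ → EuclideanSpace ℝ (Fin 3) → EuclideanSpace ℝ (Fin 3))
      (p : ℝ → EuclideanSpace ℝ (Fin 3) → ℝ), IsMaximalSmoothSolution ν 0 u p T →
      IsLerayHopfOn T ν 0 (u 0) u → HasRapidSpatialDecay (u 0) → IsTypeIBlowup u T →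
      (∃ K : ℝ, ∀ a b : ℝ, 0 ≤ a → a ≤ b → b ≤ T →
        ∫⁻ t in Set.Ioo a b, ∫⁻ x, ‖curl (u t) x‖ₑ ^ 2 ≤ ENNReal.ofReal (K * Real.sqrt (b - a))) →
      ∃ K' : ℝ, ∀ t ∈ Set.Ico 0 T,
        ∫⁻ x, ‖curl (u t) x‖ₑ ^ 2 ≤ ENNReal.ofReal (K' / Real.sqrt (T - t)) := by
  intro ν T hν hT u p hmax hLH hdec hTI hW
  have hsol : IsClassicalNSSolutionOn (Ico 0 T) ν 0 u p := hmax.1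
  -- notation
  set E : ℝ → ℝ≥0∞ := fun t => ∫⁻ x, ENNReal.ofReal (frobeniusNormSq (fderiv ℝ (u t) x)) with hEdef
  set Ω : ℝ → ℝ≥0∞ := fun t => ∫⁻ x, ‖curl (u t) x‖ₑ ^ 2 with hΩdef
  set cc : ℝ := ‖curlCLM‖ ^ 2 with hccdef
  have hcc0 : 0 ≤ cc := sq_nonneg _
  -- `∫|∇u|² ≤ ∫|curl u|²` (div–curl, slices in `L²`) and `∫|curl u|² ≤ cc ∫|∇u|²`
  have hEΩ : ∀ s ∈ Ico 0 T, E s ≤ Ω s := fun s hs =>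
    lintegral_frobeniusNormSq_fderiv_le_lintegral_sq_norm_curl
      ((hsol.contDiff_velocity hs).of_le (by norm_cast)) (hsol.divFree s hs)
      (lt_of_le_of_lt (hLH.lintegral_enorm_sq_le hν.le ⟨hs.1, hs.2.le⟩) ENNReal.ofReal_lt_top)
  have hΩE : ∀ s, Ω s ≤ ENNReal.ofReal cc * E s := fun s => lintegral_enorm_curl_sq_le (u s)
  -- the window law with a nonnegative constant
  obtain ⟨K, hK⟩ := hW
  set Kp : ℝ := max K 0 with hKpdef
  have hKp0 : 0 ≤ Kp := le_max_right _ _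
  have hKp : ∀ a b : ℝ, 0 ≤ a → a ≤ b → b ≤ T →
      ∫⁻ t in Ioo a b, Ω t ≤ ENNReal.ofReal (Kp * Real.sqrt (b - a)) := fun a b ha hab hb =>
    (hK a b ha hab hb).trans (ENNReal.ofReal_le_ofReal
      (mul_le_mul_of_nonneg_right (le_max_left _ _) (Real.sqrt_nonneg _)))
  -- Tao's class on closed sub-slabs
  have hTao : ∀ T'' < T, HasBoundedSobolevNormsOn (Icc 0 T'') u :=
    Summit.NavierStokesRegularity.StrongHypotheses.hasBoundedSobolevNormsOn_of_classical_lerayHopf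
      hν hsol hLH hdec
  -- the Type-I window `(t₁, T)`
  obtain ⟨C, hC⟩ := hTI
  obtain ⟨l, hl, hsub⟩ := mem_nhdsLT_iff_exists_Ioo_subset.1 hC
  set t₁ : ℝ := max l 0 with ht₁def
  have ht₁0 : 0 ≤ t₁ := le_max_right _ _
  have ht₁T : t₁ < T := max_lt hl hT
  have hC' : ∀ t, t₁ < t → t < T → ∀ x, ‖u t x‖ ≤ C / Real.sqrt (T - t) := fun t h1 h2 =>
    hsub ⟨(le_max_left _ _).trans_lt h1, h2⟩
  set Cp : ℝ := max C 0 with hCpdef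
  have hCp0 : 0 ≤ Cp := le_max_right _ _
  set t₂ : ℝ := (t₁ + T) / 2 with ht₂def
  have ht₂T : t₂ < T := by rw [ht₂def]; linarith
  have ht₁₂ : t₁ < t₂ := by rw [ht₂def]; linarith
  have ht₂0 : 0 < t₂ := lt_of_le_of_lt ht₁0 ht₁₂
  -- `|u| ≤ B` on `[0, t₂]`
  obtain ⟨B₀, hB₀⟩ := linfty_bound_of_hasBoundedSobolevNormsOn_holds
    (fun t ht => (hsol.contDiff_velocity ⟨ht.1, ht.2.trans_lt ht₂T⟩).of_le (by norm_cast))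
    (hTao t₂ ht₂T)
  set B : ℝ := max B₀ 0 with hBdef
  have hB0 : 0 ≤ B := le_max_right _ _
  have hB : ∀ t ∈ Icc 0 t₂, ∀ x, ‖u t x‖ ≤ B := fun t ht x => (hB₀ t ht x).trans (le_max_left _ _)
  -- the rate
  obtain ⟨κ, hκ0, hrate⟩ := exists_enstrophy_rate hν
  -- `∫|∇u(0)|² < ∞`
  have hE0 : E 0 < ⊤ := by
    calc E 0 ≤ ∫⁻ x, 3 * ‖iteratedFDeriv ℝ 1 (u 0) x‖ₑ ^ 2 := lintegral_mono fun x => by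
          rw [← ofReal_norm, norm_iteratedFDeriv_one, ofReal_norm]
          exact ofReal_frobeniusNormSq_le_three_mul_enorm_sq _
      _ = 3 * ∫⁻ x, ‖iteratedFDeriv ℝ 1 (u 0) x‖ₑ ^ 2 := lintegral_const_mul' _ _ (by norm_num)
      _ < ⊤ := ENNReal.mul_lt_top (by simp) (hdec.lintegral_enorm_iteratedFDeriv_sq_lt_top 1)
  set e₀ : ℝ := (E 0).toReal with he₀def
  have he₀0 : 0 ≤ e₀ := ENNReal.toReal_nonneg
  have hE0eq : E 0 = ENNReal.ofReal e₀ := (ENNReal.ofReal_toReal hE0.ne).symm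
  -- the constants
  set L : ℝ := max (B ^ 2 * T) (Cp ^ 2) with hLdef
  set K₁ : ℝ := Real.exp (κ * L) * Kp with hK₁def
  set K₂ : ℝ := Real.exp (κ * (B ^ 2 * T)) * e₀ * Real.sqrt T with hK₂def
  have hK₁0 : 0 ≤ K₁ := by positivity
  have hK₂0 : 0 ≤ K₂ := by positivity
  refine ⟨cc * (K₁ + K₂), fun t ht => ?_⟩
  have hTt : 0 < T - t := sub_pos.2 ht.2
  have hsq : 0 < Real.sqrt (T - t) := Real.sqrt_pos.2 hTt
  rcases lt_or_ge t t₂ with htlt | htge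
  · /- early times: Grönwall from `0` on the slab `[0, t₂]` -/
    have hsol₂ : IsClassicalNSSolutionOn (Icc 0 t₂) ν 0 u p :=
      hsol.mono (fun s hs => ⟨hs.1, hs.2.trans_lt ht₂T⟩) (uniqueDiffOn_Icc ht₂0)
    have h1 : E t ≤ ENNReal.ofReal (Real.exp (κ * (B ^ 2 * t))) * E 0 :=
      hrate ht₂0 hsol₂ (hTao t₂ ht₂T) hB0 hB t ⟨ht.1, htlt.le⟩
    have h2 : E t ≤ ENNReal.ofReal (Real.exp (κ * (B ^ 2 * T)) * e₀) := by
      refine h1.trans ?_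
      rw [hE0eq, ← ENNReal.ofReal_mul (Real.exp_nonneg _)]
      refine ENNReal.ofReal_le_ofReal (mul_le_mul_of_nonneg_right ?_ he₀0)
      exact Real.exp_le_exp.2 (mul_le_mul_of_nonneg_left
        (mul_le_mul_of_nonneg_left (htlt.le.trans ht₂T.le) (sq_nonneg _)) hκ0)
    calc Ω t ≤ ENNReal.ofReal cc * E t := hΩE t
      _ ≤ ENNReal.ofReal cc * ENNReal.ofReal (Real.exp (κ * (B ^ 2 * T)) * e₀) := by gcongr
      _ = ENNReal.ofReal (cc * (Real.exp (κ * (B ^ 2 * T)) * e₀)) := by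
          rw [ENNReal.ofReal_mul hcc0]
      _ ≤ ENNReal.ofReal (cc * (K₁ + K₂) / Real.sqrt (T - t)) := by
          refine ENNReal.ofReal_le_ofReal ?_
          rw [le_div_iff₀ hsq]
          have hst : Real.sqrt (T - t) ≤ Real.sqrt T := Real.sqrt_le_sqrt (by linarith [ht.1])
          have h3 : Real.exp (κ * (B ^ 2 * T)) * e₀ * Real.sqrt (T - t) ≤ K₂ := by
            rw [hK₂def]; gcongr
          have h4 : 0 ≤ Real.exp (κ * (B ^ 2 * T)) * e₀ := by positivity
          nlinarith [mul_nonneg hcc0 hK₁0, mul_le_mul_of_nonneg_left h3 hcc0]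
  · /- late times: Grönwall over the window `[2t − T, t]`, averaged -/
    have ht0 : 0 < t := ht₂0.trans_le htge
    have h2tT : 0 ≤ 2 * t - T := by rw [ht₂def] at htge; linarith
    -- the sup bound on `[0, t]`
    set M : ℝ := max B (Cp / Real.sqrt (T - t)) with hMdef
    have hM0 : 0 ≤ M := hB0.trans (le_max_left _ _)
    have hM : ∀ s ∈ Icc 0 t, ∀ x, ‖u s x‖ ≤ M := by
      intro s hs x
      rcases le_or_gt s t₁ with hs1 | hs1
      · exact (hB s ⟨hs.1, hs1.trans ht₁₂.le⟩ x).trans (le_max_left _ _)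
      · have hsT : s < T := hs.2.trans_lt ht.2
        refine (hC' s hs1 hsT x).trans ((le_max_right _ _).trans' ?_)
        have hss : 0 < Real.sqrt (T - s) := Real.sqrt_pos.2 (sub_pos.2 hsT)
        calc C / Real.sqrt (T - s) ≤ Cp / Real.sqrt (T - s) :=
              div_le_div_of_nonneg_right (le_max_left _ _) hss.le
          _ ≤ Cp / Real.sqrt (T - t) :=
              div_le_div_of_nonneg_left hCp0 hsq (Real.sqrt_le_sqrt (by linarith [hs.2]))
    have hML : M ^ 2 * (T - t) ≤ L := by
      rcases max_choice B (Cp / Real.sqrt (T - t)) with h | h <;> rw [hMdef, h]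
      · calc B ^ 2 * (T - t) ≤ B ^ 2 * T :=
              mul_le_mul_of_nonneg_left (by linarith [ht.1]) (sq_nonneg _)
          _ ≤ L := le_max_left _ _
      · rw [div_pow, Real.sq_sqrt hTt.le, div_mul_cancel₀ _ hTt.ne']
        exact le_max_right _ _
    have hsolt : IsClassicalNSSolutionOn (Icc 0 t) ν 0 u p :=
      hsol.mono (fun s hs => ⟨hs.1, hs.2.trans_lt ht.2⟩) (uniqueDiffOn_Icc ht0)
    have hubt : HasBoundedSobolevNormsOn (Icc 0 t) u := hTao t ht.2
    -- Grönwall over the window, for each starting time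
    have hwin : ∀ s ∈ Ioo (2 * t - T) t, E t ≤ ENNReal.ofReal (Real.exp (κ * L)) * E s := by
      intro s hs
      have hs0 : 0 ≤ s := h2tT.trans hs.1.le
      have hts : 0 < t - s := sub_pos.2 hs.2
      -- the shifted flow on `[0, t - s]`
      have hsol' : IsClassicalNSSolutionOn (Icc 0 (t - s)) ν 0 (fun r => u (r + s))
          (fun r => p (r + s)) :=
        (hsol.translate_Ico_zero hs0).mono (fun r hr => ⟨hr.1, by linarith [hr.2, ht.2]⟩)
          (uniqueDiffOn_Icc hts)
      have hub' : HasBoundedSobolevNormsOn (Icc 0 (t - s)) (fun r => u (r + s)) :=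
        TaoForcedJ1.hasBoundedSobolevNormsOn_shift hubt hs0 (by linarith)
      have hM' : ∀ r ∈ Icc 0 (t - s), ∀ x, ‖(fun r => u (r + s)) r x‖ ≤ M :=
        fun r hr x => hM (r + s) ⟨by linarith [hr.1], by linarith [hr.2]⟩ x
      have h1 := hrate hts hsol' hub' hM0 hM' (t - s) ⟨hts.le, le_rfl⟩
      simp only [sub_add_cancel, zero_add] at h1
      refine h1.trans (mul_le_mul_left (ENNReal.ofReal_le_ofReal (Real.exp_le_exp.2 ?_)) _)
      refine mul_le_mul_of_nonneg_left ?_ hκ0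
      calc M ^ 2 * (t - s) ≤ M ^ 2 * (T - t) :=
            mul_le_mul_of_nonneg_left (by linarith [hs.1]) (sq_nonneg _)
        _ ≤ L := hML
    -- average over the window and use the window law
    have havg : E t * ENNReal.ofReal (T - t) ≤
        ENNReal.ofReal (Real.exp (κ * L)) * ENNReal.ofReal (Kp * Real.sqrt (T - t)) := by
      have h1 : E t * ENNReal.ofReal (T - t) = ∫⁻ _ in Ioo (2 * t - T) t, E t := by
        rw [setLIntegral_const, Real.volume_Ioo]
        congr 2
        ring
      rw [h1]
      calc ∫⁻ _ in Ioo (2 * t - T) t, E t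
          ≤ ∫⁻ s in Ioo (2 * t - T) t, ENNReal.ofReal (Real.exp (κ * L)) * E s :=
            setLIntegral_mono' measurableSet_Ioo fun s hs => hwin s hs
        _ = ENNReal.ofReal (Real.exp (κ * L)) * ∫⁻ s in Ioo (2 * t - T) t, E s :=
            lintegral_const_mul' _ _ ENNReal.ofReal_ne_top
        _ ≤ ENNReal.ofReal (Real.exp (κ * L)) * ∫⁻ s in Ioo (2 * t - T) t, Ω s :=
            mul_le_mul_right (setLIntegral_mono' measurableSet_Ioo fun s hs =>
              hEΩ s ⟨h2tT.trans hs.1.le, hs.2.trans ht.2⟩) _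
        _ ≤ ENNReal.ofReal (Real.exp (κ * L)) * ENNReal.ofReal (Kp * Real.sqrt (T - t)) := by
            refine mul_le_mul_right ?_ _
            have h := hKp (2 * t - T) t h2tT (by linarith) ht.2.le
            rwa [show t - (2 * t - T) = T - t by ring] at h
    have hEt : E t ≤ ENNReal.ofReal (K₁ / Real.sqrt (T - t)) := by
      have hne0 : ENNReal.ofReal (T - t) ≠ 0 := by simpa using hTt
      rw [← ENNReal.ofReal_mul (Real.exp_nonneg _)] at havg
      have h2 : E t ≤ ENNReal.ofReal (Real.exp (κ * L) * (Kp * Real.sqrt (T - t))) /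
          ENNReal.ofReal (T - t) :=
        (ENNReal.le_div_iff_mul_le (Or.inl hne0) (Or.inl ENNReal.ofReal_ne_top)).2 havg
      refine h2.trans (le_of_eq ?_)
      rw [← ENNReal.ofReal_div_of_pos hTt]
      congr 1
      rw [hK₁def, div_eq_div_iff hTt.ne' hsq.ne']
      calc Real.exp (κ * L) * (Kp * Real.sqrt (T - t)) * Real.sqrt (T - t)
          = Real.exp (κ * L) * Kp * (Real.sqrt (T - t) * Real.sqrt (T - t)) := by ring
        _ = Real.exp (κ * L) * Kp * (T - t) := by rw [Real.mul_self_sqrt hTt.le]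
    calc Ω t ≤ ENNReal.ofReal cc * E t := hΩE t
      _ ≤ ENNReal.ofReal cc * ENNReal.ofReal (K₁ / Real.sqrt (T - t)) := by gcongr
      _ = ENNReal.ofReal (cc * (K₁ / Real.sqrt (T - t))) := by rw [ENNReal.ofReal_mul hcc0]
      _ ≤ ENNReal.ofReal (cc * (K₁ + K₂) / Real.sqrt (T - t)) := by
          refine ENNReal.ofReal_le_ofReal ?_
          have hre : cc * (K₁ / Real.sqrt (T - t)) = cc * K₁ / Real.sqrt (T - t) :=
            (mul_div_assoc _ _ _).symm
          rw [hre]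
          exact div_le_div_of_nonneg_right
            (mul_le_mul_of_nonneg_left (le_add_of_nonneg_right hK₂0) hcc0) hsq.le

end EnstrophyQuarterLaw

/-- **The `window_average` composition BY NAME** (skeleton theorem of
`Cruxes/EnstrophyQuarterLaw/Lines/window_average.lean` with its two open stubs as hypotheses): sup-norm
Type I at every finite classical lifespan (`TypeIliouvilleNoTypeII`, stmt-0056) and the window quarter
law (`EnergyHalfHolder`, stmt-25161) give the slice quarter law (`EnstrophyQuarterLaw`, stmt-1574), by
`EnstrophyQuarterLaw.stub_windowToSlice`. Both hypotheses are OPEN; only the implication is asserted.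
[folklore] -/
theorem enstrophyQuarterLaw_of_noTypeII_of_energyHalfHolder
    (hR : Theses.TypeILiouville.TypeIliouvilleNoTypeII) (hW : Theses.HalfHolderEnergy.EnergyHalfHolder) :
    Theses.StretchingWellBinding.EnstrophyQuarterLaw := by
  intro ν T hν hT u p hmax hLH hdec
  exact EnstrophyQuarterLaw.stub_windowToSlice ν T hν hT u p hmax hLH hdec
    (hR ν T hν hT u p hmax hLH hdec)
    (hW ν T hν hT u p hmax hLH hdec)

end Summit.NavierStokesRegularity.NavierStokesRegularity.Theorems

end
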